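import Summits.QuantumFields.YangMills.Theorems.BalabanLadderIRTwistedSlabSliceChart
import HarnessLib

/-!
# The slice chart on `𝔰𝔲` data is `C^∞` NEAR `0` (not only at `0`): the `𝔰𝔲`-projection trick, local `C¹` package with continuous
# derivative on an open neighbourhood, injectivity on the IFT source (Jacobian-side input of the `hchart` identity of M1b)

HELPER toward stub **T1** `TwistedSlabAnchor` (LINE `twisted-slab-continuity`, crux `IRcof` stmt-QuantumFields-26930, census row 43;
LEAD prover ym-ir-line-tsc-p1 g3; `--supports` the crux, `--as helper`).  Sequel of K15a/K15b (`…LogChart`, `…SliceChart`).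
Method: the `ℝ`-linear projection `suProj` onto traceless skew-Hermitian fields (`A ↦ ½(A − Aᴴ) − tr(½(A − Aᴴ))∕N · 1` componentwise) is a
continuous linear left inverse of the inclusion `suPiIncl`, so near `0` the `𝔰𝔲`-valued chart `Ψ̂ = slicePsiSu L` equals
`suProj ∘ Ψ ∘ suDataIncl` — a composition of continuous linear maps with the ambient chart, which is `C^∞` wherever the window condition holds
(K15a `contDiffAt_slicePsi`); hence `Ψ̂` is `C^n` at every point near `0`, with the usual consequences.
* §1 `skewTracelessPart`, `suProj` (+ `_apply`, `suProj_suPiIncl` : left inverse).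
* §2 `slicePsiSu_eventuallyEq_suProj`; ★ `eventually_contDiffAt_slicePsiSu` (`∀ᶠ q in 𝓝 0, ContDiffAt ℝ n Ψ̂ q`, every `n`, any `L ∈ SU(N)^E`);
  `eventually_hasFDerivAt_slicePsiSu`, `eventually_continuousAt_fderiv_slicePsiSu`; ★ `exists_isOpen_slicePsiSu_hasFDerivAt` — an OPEN `U ∋ 0` on which
  `Ψ̂` has derivative `fderiv ℝ Ψ̂ q` at every point and `q ↦ fderiv ℝ Ψ̂ q` is continuous (the `C¹` data `hΨ'` of lit-4's L16
  `haar_restrict_image_reparam_eq_map_withDensity_frame`, stated topologically so that it can be consumed under any matrix-norm scope).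
* §3 (twist-eating ladder) `fderiv_slicePsiSu_zero` (`= slicePsiSuDeriv`), `injOn_slicePsiSu_sliceChart_source`, `isOpen_sliceChart_source`,
  `sliceChart_source_mem_nhds` (the injectivity data `hinj` of L16 on a neighbourhood of `0`).
NOT here (honest scope): the Euclidean model / frame to B89's `piLogChart`, the Jacobian determinant and the `hchart` identity itself (next file, L2Operator
scope), FP localisation, anything uniform in `β` (M3), the cluster expansion (M4); T1-box 0∕1, T1 proper 0∕1.

HONEST FRAMING: finite-dimensional calculus on one box; nothing here bears on `IRcof`, `IR`, or the Yang–Mills mass gap (Clay: NOT proved); R4 =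
`BalabanLadder.UV` only.  References: M. García Pérez, A. González-Arroyo, M. Okawa, JHEP 10 (2017) 150 §2.3, §2.5; I. Montvay, G. Münster, *Quantum
Fields on a Lattice* §3.2.5; S. Helgason, *Groups and Geometric Analysis* Ch. I §1 Thm 1.14.
-/

set_option autoImplicit false

noncomputable section

open scoped Matrix Matrix.Norms.Frobenius Topology
open Finset NormedSpace Filter
open Literature.MathematicalPhysics.QuantumFieldTheory Literature.MathematicalPhysics.QuantumLattice
open Literature.Analysis.OperatorTheory

namespace Summit.QuantumFields.YangMills.Cruxes.IRcof.TwistedSlab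

variable {N : ℕ} {n₀ n₁ n₂ n₃ : ℕ}

/-! ## §1 The `𝔰𝔲` projection -/

section Proj

variable (N) in
/-- The traceless skew-Hermitian part of a matrix: `½(A − Aᴴ) − (tr ½(A − Aᴴ) ∕ N)·1` (an `ℝ`-linear projection of `M_N(ℂ)` onto `𝔰𝔲(N)`). [folklore] -/
def skewTracelessPart (A : Matrix (Fin N) (Fin N) ℂ) : Matrix (Fin N) (Fin N) ℂ :=
  (1 / 2 : ℂ) • (A - Aᴴ) - ((((1 / 2 : ℂ) • (A - Aᴴ)).trace / (N : ℂ)) • (1 : Matrix (Fin N) (Fin N) ℂ))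

/-- The skew part `½(A − Aᴴ)` is skew-Hermitian (private copy; the same statement is landed in a QCD helper file not worth importing). [folklore] -/
private theorem conjTranspose_half_smul_sub (A : Matrix (Fin N) (Fin N) ℂ) : ((1 / 2 : ℂ) • (A - Aᴴ))ᴴ = -((1 / 2 : ℂ) • (A - Aᴴ)) := by
  have h12 : star (1 / 2 : ℂ) = 1 / 2 := by rw [Complex.star_def, map_div₀, map_one, map_ofNat]
  rw [Matrix.conjTranspose_smul, h12, Matrix.conjTranspose_sub, Matrix.conjTranspose_conjTranspose, ← smul_neg, neg_sub]

/-- The traceless skew-Hermitian part is skew-Hermitian. [folklore] -/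
theorem conjTranspose_skewTracelessPart (A : Matrix (Fin N) (Fin N) ℂ) : (skewTracelessPart N A)ᴴ = -skewTracelessPart N A := by
  have hS := conjTranspose_half_smul_sub A
  have ht : star (((1 / 2 : ℂ) • (A - Aᴴ)).trace) = -((1 / 2 : ℂ) • (A - Aᴴ)).trace := by
    rw [← Matrix.trace_conjTranspose, hS, Matrix.trace_neg]
  rw [skewTracelessPart, Matrix.conjTranspose_sub, hS, Matrix.conjTranspose_smul, Matrix.conjTranspose_one, star_div₀, ht, Complex.star_def,
    Complex.conj_natCast, neg_div, neg_smul]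
  abel

/-- The traceless skew-Hermitian part is traceless. [folklore] -/
theorem trace_skewTracelessPart [NeZero N] (A : Matrix (Fin N) (Fin N) ℂ) : (skewTracelessPart N A).trace = 0 := by
  have hN : (N : ℂ) ≠ 0 := Nat.cast_ne_zero.2 (NeZero.ne N)
  rw [skewTracelessPart, Matrix.trace_sub, Matrix.trace_smul (((1 / 2 : ℂ) • (A - Aᴴ)).trace / (N : ℂ)), Matrix.trace_one, Fintype.card_fin,
    smul_eq_mul, div_mul_cancel₀ _ hN, sub_self]

/-- On `𝔰𝔲(N)` the projection is the identity. [folklore] -/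
theorem skewTracelessPart_of_mem {A : Matrix (Fin N) (Fin N) ℂ} (hA : Aᴴ = -A) (htr : A.trace = 0) : skewTracelessPart N A = A := by
  have h2 : (1 / 2 : ℂ) • (A - Aᴴ) = A := by
    rw [hA, sub_neg_eq_add, ← two_smul ℂ A, smul_smul]; norm_num
  rw [skewTracelessPart, h2, htr, zero_div, zero_smul, sub_zero]

/-- `skewTracelessPart` is additive. [folklore] -/
theorem skewTracelessPart_add (A B : Matrix (Fin N) (Fin N) ℂ) :
    skewTracelessPart N (A + B) = skewTracelessPart N A + skewTracelessPart N B := by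
  rw [skewTracelessPart, skewTracelessPart, skewTracelessPart, Matrix.conjTranspose_add,
    show A + B - (Aᴴ + Bᴴ) = (A - Aᴴ) + (B - Bᴴ) by abel, smul_add, Matrix.trace_add, add_div, add_smul]
  abel

/-- `skewTracelessPart` is `ℝ`-homogeneous. [folklore] -/
theorem skewTracelessPart_smul (c : ℝ) (A : Matrix (Fin N) (Fin N) ℂ) :
    skewTracelessPart N (c • A) = c • skewTracelessPart N A := by
  have hc : (c • A : Matrix (Fin N) (Fin N) ℂ) = (c : ℂ) • A := RCLike.real_smul_eq_coe_smul (K := ℂ) c A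
  have hct : ((c : ℂ) • A)ᴴ = (c : ℂ) • Aᴴ := by rw [Matrix.conjTranspose_smul, Complex.star_def, Complex.conj_ofReal]
  rw [hc, RCLike.real_smul_eq_coe_smul (K := ℂ) c (skewTracelessPart N A), skewTracelessPart, skewTracelessPart, hct, ← smul_sub,
    smul_comm (1 / 2 : ℂ) (c : ℂ), Matrix.trace_smul ((c : ℂ)), smul_eq_mul, mul_div_assoc, ← smul_smul, ← smul_sub]
  rfl

variable (N n₀ n₁ n₂ n₃) in
/-- **The `𝔰𝔲` projection of field configurations**: componentwise `skewTracelessPart`, as a continuous linear map onto `Fin 4 → suFields`. [folklore] -/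
def suProj [NeZero N] : (Fin 4 → FinTorusSite n₀ n₁ n₂ n₃ → Matrix (Fin N) (Fin N) ℂ) →L[ℝ] (Fin 4 → suFields N n₀ n₁ n₂ n₃) :=
  LinearMap.toContinuousLinearMap
    { toFun := fun v μ => ⟨fun x => skewTracelessPart N (v μ x), fun x => ⟨conjTranspose_skewTracelessPart _, trace_skewTracelessPart _⟩⟩
      map_add' := fun v w => by
        funext μ; apply Subtype.ext; funext x
        show skewTracelessPart N ((v + w) μ x) = skewTracelessPart N (v μ x) + skewTracelessPart N (w μ x)
        rw [Pi.add_apply, Pi.add_apply, skewTracelessPart_add]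
      map_smul' := fun c v => by
        funext μ; apply Subtype.ext; funext x
        show skewTracelessPart N ((c • v) μ x) = c • skewTracelessPart N (v μ x)
        rw [Pi.smul_apply, Pi.smul_apply, skewTracelessPart_smul] }

/-- Components of `suProj`. [folklore] -/
theorem coe_suProj_apply [NeZero N] (v : Fin 4 → FinTorusSite n₀ n₁ n₂ n₃ → Matrix (Fin N) (Fin N) ℂ) (μ : Fin 4) (x : FinTorusSite n₀ n₁ n₂ n₃) :
    ((suProj N n₀ n₁ n₂ n₃ v μ : suFields N n₀ n₁ n₂ n₃) : FinTorusSite n₀ n₁ n₂ n₃ → Matrix (Fin N) (Fin N) ℂ) x = skewTracelessPart N (v μ x) := rfl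

/-- ★ `suProj` is a left inverse of the inclusion `suPiIncl`. [folklore] -/
theorem suProj_suPiIncl [NeZero N] (v : Fin 4 → suFields N n₀ n₁ n₂ n₃) : suProj N n₀ n₁ n₂ n₃ (suPiIncl N n₀ n₁ n₂ n₃ v) = v := by
  funext μ; apply Subtype.ext; funext x
  rw [coe_suProj_apply, suPiIncl_apply]
  exact skewTracelessPart_of_mem ((v μ).2 x).1 ((v μ).2 x).2

end Proj

/-! ## §2 `Ψ̂` is `C^∞` near `0` -/

section Smooth

variable [NeZero N] {L : FinTorusSite n₀ n₁ n₂ n₃ × Fin 4 → Matrix (Fin N) (Fin N) ℂ}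

/-- Near `0`, `Ψ̂ = suProj ∘ Ψ ∘ suDataIncl` (`L ∈ SU(N)^E`). [folklore] -/
theorem slicePsiSu_eventuallyEq_suProj (hL : ∀ e, L e ∈ Matrix.specialUnitaryGroup (Fin N) ℂ) :
    slicePsiSu L =ᶠ[𝓝 0] fun q => suProj N n₀ n₁ n₂ n₃ (slicePsi L (suDataIncl L q)) :=
  (eventually_coe_slicePsiSu hL).mono fun q hq => by
    have h := congrArg (suProj N n₀ n₁ n₂ n₃) hq
    rwa [suProj_suPiIncl] at h

/-- ★ **`Ψ̂` IS `C^n` AT EVERY POINT NEAR `0`** (every `n`; `L ∈ SU(N)^E`): near `0` it is `suProj ∘ Ψ ∘ suDataIncl` locally, and `Ψ` is `C^n` wherever the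
window condition holds (K15a). [cite: Helgason2000, Ch. I §1 Thm 1.14 p. 96] -/
theorem eventually_contDiffAt_slicePsiSu (hL : ∀ e, L e ∈ Matrix.specialUnitaryGroup (Fin N) ℂ) {n : WithTop ℕ∞} :
    ∀ᶠ q in 𝓝 (0 : suFields N n₀ n₁ n₂ n₃ × realCoulombSlice L), ContDiffAt ℝ n (slicePsiSu L) q := by
  have hLu : ∀ e, L e ∈ Matrix.unitaryGroup (Fin N) ℂ := fun e => (Matrix.mem_specialUnitaryGroup_iff.1 (hL e)).1
  have ht : Tendsto (suDataIncl L) (𝓝 0) (𝓝 0) := by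
    have h := (suDataIncl L).continuous.tendsto 0
    rwa [map_zero] at h
  have hwin := ht.eventually (eventually_norm_orbitFluct_mul_conjTranspose_sub_one_lt hLu one_pos)
  filter_upwards [hwin, (slicePsiSu_eventuallyEq_suProj hL).eventually_nhds] with q hq hloc
  have hΨ : ContDiffAt ℝ n (slicePsi L) (suDataIncl L q) := contDiffAt_slicePsi hq
  have hcomp : ContDiffAt ℝ n (fun q' => suProj N n₀ n₁ n₂ n₃ (slicePsi L (suDataIncl L q'))) q :=
    (suProj N n₀ n₁ n₂ n₃).contDiff.contDiffAt.comp q (hΨ.comp q (suDataIncl L).contDiff.contDiffAt)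
  exact hcomp.congr_of_eventuallyEq hloc

/-- Near `0`, `Ψ̂` is (strictly) differentiable with derivative `fderiv ℝ Ψ̂ q`. [folklore] -/
theorem eventually_hasStrictFDerivAt_slicePsiSu (hL : ∀ e, L e ∈ Matrix.specialUnitaryGroup (Fin N) ℂ) :
    ∀ᶠ q in 𝓝 (0 : suFields N n₀ n₁ n₂ n₃ × realCoulombSlice L), HasStrictFDerivAt (slicePsiSu L) (fderiv ℝ (slicePsiSu L) q) q :=
  (eventually_contDiffAt_slicePsiSu hL (n := 1)).mono fun _ hq => hq.hasStrictFDerivAt (by simp)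

/-- Near `0`, `q ↦ fderiv ℝ Ψ̂ q` is continuous. [folklore] -/
theorem eventually_continuousAt_fderiv_slicePsiSu (hL : ∀ e, L e ∈ Matrix.specialUnitaryGroup (Fin N) ℂ) :
    ∀ᶠ q in 𝓝 (0 : suFields N n₀ n₁ n₂ n₃ × realCoulombSlice L), ContinuousAt (fderiv ℝ (slicePsiSu L)) q :=
  (eventually_contDiffAt_slicePsiSu hL (n := 1)).mono fun _ hq => hq.continuousAt_fderiv (by simp)

/-- ★ **LOCAL `C¹` PACKAGE**: an open `U ∋ 0` on which `Ψ̂` has derivative `fderiv ℝ Ψ̂ q` at every `q` and `fderiv ℝ Ψ̂` is continuous — the data `hΨ'`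
(and, with the next file's frame, `hΨ'm`) of lit-4's `haar_restrict_image_reparam_eq_map_withDensity_frame`, stated topologically.
[cite: Breitung1994, §2.3 Definitions 4–5 pp. 14–15] -/
theorem exists_isOpen_slicePsiSu_hasFDerivAt (hL : ∀ e, L e ∈ Matrix.specialUnitaryGroup (Fin N) ℂ) :
    ∃ U : Set (suFields N n₀ n₁ n₂ n₃ × realCoulombSlice L), IsOpen U ∧ (0 : suFields N n₀ n₁ n₂ n₃ × realCoulombSlice L) ∈ U ∧
      (∀ q ∈ U, HasFDerivAt (slicePsiSu L) (fderiv ℝ (slicePsiSu L) q) q) ∧ ContinuousOn (fderiv ℝ (slicePsiSu L)) U := by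
  have h := (eventually_hasStrictFDerivAt_slicePsiSu hL).and (eventually_continuousAt_fderiv_slicePsiSu hL)
  obtain ⟨U, hU, hUo, hU0⟩ := eventually_nhds_iff.1 h
  exact ⟨U, hUo, hU0, fun q hq => (hU q hq).1.hasFDerivAt, fun q hq => (hU q hq).2.continuousWithinAt⟩

end Smooth

/-! ## §3 At the twist-eating ladder: the derivative at `0` and injectivity on the IFT source -/

section Ladder

variable [NeZero N] {m n₂' n₃' : ℕ} {A B : Matrix (Fin N) (Fin N) ℂ} {ω : ℂ} {Γ₂ Γ₃ : Matrix (Fin N) (Fin N) ℂ}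

/-- `fderiv ℝ Ψ̂ 0 = slicePsiSuDeriv` (the invertible differential). [cite: GarciaperezGonzalezarroyoOkawa2017, §2.5] -/
theorem fderiv_slicePsiSu_zero (hAu : A ∈ Matrix.unitaryGroup (Fin N) ℂ) (hBu : B ∈ Matrix.unitaryGroup (Fin N) ℂ) (hω : IsPrimitiveRoot ω N)
    (hAB : A * B = ω • (B * A)) (hNm : 2 ≤ N * (m + 1))
    (hL : ∀ e, ladderField (n₀ := m + 1) (n₁ := m + 1) (n₂ := n₂') (n₃ := n₃') ![A, B, Γ₂, Γ₃] e ∈ Matrix.specialUnitaryGroup (Fin N) ℂ) :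
    fderiv ℝ (slicePsiSu (ladderField (n₀ := m + 1) (n₁ := m + 1) (n₂ := n₂') (n₃ := n₃') ![A, B, Γ₂, Γ₃])) 0 =
      (slicePsiSuDeriv hAu hBu hω hAB hNm hL : _ →L[ℝ] (Fin 4 → suFields N (m + 1) (m + 1) n₂' n₃')) :=
  (hasStrictFDerivAt_slicePsiSu_zero hAu hBu hω hAB hNm hL).hasFDerivAt.fderiv

/-- The source of the slice chart is open. [folklore] -/
theorem isOpen_sliceChart_source (hAu : A ∈ Matrix.unitaryGroup (Fin N) ℂ) (hBu : B ∈ Matrix.unitaryGroup (Fin N) ℂ) (hω : IsPrimitiveRoot ω N)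
    (hAB : A * B = ω • (B * A)) (hNm : 2 ≤ N * (m + 1))
    (hL : ∀ e, ladderField (n₀ := m + 1) (n₁ := m + 1) (n₂ := n₂') (n₃ := n₃') ![A, B, Γ₂, Γ₃] e ∈ Matrix.specialUnitaryGroup (Fin N) ℂ) :
    IsOpen (sliceChart hAu hBu hω hAB hNm hL).source :=
  (sliceChart hAu hBu hω hAB hNm hL).open_source

/-- The source of the slice chart is a neighbourhood of `0`. [folklore] -/
theorem sliceChart_source_mem_nhds (hAu : A ∈ Matrix.unitaryGroup (Fin N) ℂ) (hBu : B ∈ Matrix.unitaryGroup (Fin N) ℂ) (hω : IsPrimitiveRoot ω N)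
    (hAB : A * B = ω • (B * A)) (hNm : 2 ≤ N * (m + 1))
    (hL : ∀ e, ladderField (n₀ := m + 1) (n₁ := m + 1) (n₂ := n₂') (n₃ := n₃') ![A, B, Γ₂, Γ₃] e ∈ Matrix.specialUnitaryGroup (Fin N) ℂ) :
    (sliceChart hAu hBu hω hAB hNm hL).source ∈
      𝓝 (0 : suFields N (m + 1) (m + 1) n₂' n₃' × realCoulombSlice (ladderField (n₀ := m + 1) (n₁ := m + 1) (n₂ := n₂') (n₃ := n₃') ![A, B, Γ₂, Γ₃])) :=
  (isOpen_sliceChart_source hAu hBu hω hAB hNm hL).mem_nhds (zero_mem_sliceChart_source hAu hBu hω hAB hNm hL)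

/-- ★ **`Ψ̂` is injective on the IFT source** (a neighbourhood of `0`) — the data `hinj` of lit-4's L16. [cite: MontvayMunster1994, §3.2.5 p. 122] -/
theorem injOn_slicePsiSu_sliceChart_source (hAu : A ∈ Matrix.unitaryGroup (Fin N) ℂ) (hBu : B ∈ Matrix.unitaryGroup (Fin N) ℂ)
    (hω : IsPrimitiveRoot ω N) (hAB : A * B = ω • (B * A)) (hNm : 2 ≤ N * (m + 1))
    (hL : ∀ e, ladderField (n₀ := m + 1) (n₁ := m + 1) (n₂ := n₂') (n₃ := n₃') ![A, B, Γ₂, Γ₃] e ∈ Matrix.specialUnitaryGroup (Fin N) ℂ) :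
    Set.InjOn (slicePsiSu (ladderField (n₀ := m + 1) (n₁ := m + 1) (n₂ := n₂') (n₃ := n₃') ![A, B, Γ₂, Γ₃]))
      (sliceChart hAu hBu hω hAB hNm hL).source := by
  rw [← sliceChart_coe hAu hBu hω hAB hNm hL]
  exact (sliceChart hAu hBu hω hAB hNm hL).injOn

end Ladder


end Summit.QuantumFields.YangMills.Cruxes.IRcof.TwistedSlab

end
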